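import Literature.Analysis.FluidPDE.Tao2016AveragedNS.SplitCascadeScaleOneRegime
import Literature.Analysis.FluidPDE.Tao2016AveragedNS.SplitCascadeRescaledExit
import Literature.Analysis.FluidPDE.TaoCascadeSmallScaleOneInRegime
import HarnessLib

/-!
# The split Prop. 6.5, Prop. 6.13 in the regime with the implied constants absorbed (port of `TaoCascadeSmallScaleOneInRegime`, pointwise part)

T. Tao, *Finite time blowup for an averaged three-dimensional Navier–Stokes equation*,
arXiv:1402.0290v3, §6.6 Prop. 6.13 (6.115)–(6.119).
HONEST FRAMING: statements about the SPLIT cascade model system; nothing here proves the split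
Prop. 6.5 and nothing here concerns the true Navier–Stokes equations.

Split counterpart of `RescaledHypotheses.smallScaleOne_absorbed` (the pointwise half of
`TaoCascadeSmallScaleOneInRegime.lean`): for hypotheses with error constant `C₁/2` and an asymmetry
window on `[0, T]`, the bounds (6.115)–(6.119) with absorbed constants — the `c`-level for the sum
`|c̃₁| + |Z̃_{c,1}|`, the largeness `24·K⁻³⁰C₃G₇₄₇ ≤ K^{-1/4}`, and the one-sided (6.118) keeping the
`a`-asymmetry integral `e^{(6/100)K¹⁰}∫_{τ₀}^t (1+ε₀)^{5/2}ε²e^{-K¹⁰}Z̃²_{a,1}` (whose `n₀`-smallness is the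
separate whole-past asymmetry lemma). The `InRegime` half of the tree file is assembly-level and not
ported here.

## References

* T. Tao, arXiv:1402.0290v3, §6.6 Prop. 6.13. [`Tao2016AveragedNS`]
-/

noncomputable section

open Set MeasureTheory intervalIntegral Filter

namespace Literature.Analysis.FluidPDE

namespace Tao2016AveragedNS

open TaoCascade
open Literature.Analysis.ODE

section Pointwise

variable {γ ε₀ K ε C₁ C₂ C₃ : ℝ} {n₀ N : ℤ} {ηp : ℤ → ℝ} {βp : ℕ → ℝ} {τ : ℤ → ℝ}
  {Xr : Fin 4 → ℤ → ℝ → ℝ} {W : Fin 3 → ℤ → ℝ → ℝ} {Er : ℤ → ℝ → ℝ}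

/-- **Prop. 6.13 in the absorbed form of `SmallScaleOneInput`, pointwise**: under the parameter
inequalities of `prop613_regime` / `prop613_d_one_lt` (with `hKf` split into its `K`- and
`n₀`-halves) and the absorption inequality for (6.118), on a present interval `[0, T]`, `T ≤ 100`,
with `GoodAt` there and `∫₀ᵀ a₁² ≤ K^{-1/4}`: `|b₁| ≤ 11K^{-1/4}ε`, `|c₁| ≤ K^{-1/4}e^{-K¹⁰/2}ε²`,
`c₁ ≥ -½(1+ε₀)^{-n₀/4}`, `|d₁| < ½K⁻¹⁰`. [cite: Tao2016AveragedNS, §6.6 Prop. 6.13] -/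
theorem RescaledSplitHypotheses.smallScaleOne_absorbed
    (h : RescaledSplitHypotheses γ ε₀ K ε (C₁ / 2) C₂ C₃ n₀ N ηp βp τ Xr W Er) (hε₀ : 0 < ε₀) (hε₀1 : ε₀ < 1)
    (hK : 2 ≤ K) (hε : 0 < ε) (hε1 : ε ≤ 1) (hC₁ : 0 ≤ C₁) (hC₃ : 0 ≤ C₃) (hN : n₀ ≤ N)
    (hκ : 36 * Real.sqrt 2 * K * ((K ^ 15)⁻¹ * (1 + ε₀) ^ (-(999 : ℝ) / 100) * C₃ *
      geomConst ε₀ ((248 : ℝ) / 100)) ≤ 1)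
    (hKa : 24 * ((K ^ 30)⁻¹ * C₃ * geomConst ε₀ ((747 : ℝ) / 100)) ≤ K ^ (-(1 : ℝ) / 4))
    (hKc : 48600 * K ^ 10 * Real.exp (-(188 / 100) * K ^ 10) * K ^ (-(1 : ℝ) / 4) *
      (C₃ * geomConst ε₀ ((741 : ℝ) / 100) + 1) ≤ 1)
    (hKd : K ^ (-(1 : ℝ) / 4) * (3 * C₃ * geomConst ε₀ ((245 : ℝ) / 100) + 1100) < 1 / 100)
    (hKe : Real.exp (3600 * Real.sqrt 2 * (K ^ 14)⁻¹) ≤ 2)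
    (hKf1 : 100 * (54 * Real.sqrt 2) * K ^ (-(1 : ℝ) / 4) * Real.exp (-(94 / 100) * K ^ 10) ≤
      1 / 2 * (K ^ 15)⁻¹)
    (hδ1 : 4 * C₁ * (1 + ε₀) ^ (-(n₀ : ℝ) / 2) *
      (Real.exp 1 * (6 * Real.sqrt 2 * K) * cumEnergyConst ε₀ C₃ * C₃ * geomConst ε₀ ((496 : ℝ) / 100)) ≤
      ε ^ 2 * Real.exp (-K ^ 10) * K ^ (-(1 : ℝ) / 4))
    (hδ2 : 400 * C₁ * (1 + ε₀) ^ (-(n₀ : ℝ) / 2) ≤ ε ^ 2 * Real.exp (-K ^ 10) * K ^ (-(1 : ℝ) / 4))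
    (hδ3 : 400 * C₁ * (1 + ε₀) ^ (-(n₀ : ℝ) / 2) ≤ 1 / 2 * (K ^ 15)⁻¹)
    (hδ4 : Real.exp (6 / 100 * K ^ 10) * (4 * C₁ *
      (Real.exp 1 * (6 * Real.sqrt 2 * K) * cumEnergyConst ε₀ C₃ * C₃ * geomConst ε₀ ((496 : ℝ) / 100) +
        100)) * (1 + ε₀) ^ (-(n₀ : ℝ) / 2) ≤ 1 / 2 * (1 + ε₀) ^ (-(n₀ : ℝ) / 4))
    {T : ℝ} (hT : T ∈ Icc (0 : ℝ) 100) (hgood : ∀ t ∈ Icc 0 T, GoodAt ε₀ K Xr Er t)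
    (hP : ∫ s in (0 : ℝ)..T, Xr 0 1 s ^ 2 ≤ K ^ (-(1 : ℝ) / 4))
    {Tw ζ : ℝ} (hw : AsymWindow ε₀ K ε C₁ n₀ W Tw ζ) (hTw : T ≤ Tw) {t : ℝ} (ht : t ∈ Icc 0 T) :
    |Xr 1 1 t| ≤ 11 * K ^ (-(1 : ℝ) / 4) * ε ∧
    |Xr 2 1 t| + |W 1 1 t| ≤ K ^ (-(1 : ℝ) / 4) * Real.exp (-K ^ 10 / 2) * ε ^ 2 ∧
    -(1 / 2 * (1 + ε₀) ^ (-(n₀ : ℝ) / 4) +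
      Real.exp (6 / 100 * K ^ 10) *
        ∫ s in (τ (n₀ - N))..t, (1 + ε₀) ^ ((5 : ℝ) / 2) * ε ^ 2 * Real.exp (-K ^ 10) * W 0 1 s ^ 2) ≤
      Xr 2 1 t ∧
    |Xr 3 1 t| < 1 / 2 * (K ^ 10)⁻¹ := by
  have hq1 : (1 : ℝ) ≤ 1 + ε₀ := by linarith
  have hK1 : 1 ≤ K := by linarith
  -- `Ẽ₁ ≤ 1`, `Ẽ₂ ≤ K⁻³⁰` on `[0, T]`
  have hE1 : ∀ s ∈ Icc 0 T, Er 1 s ≤ 1 := fun s hs =>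
    h.energy_le_one_of_goodAt hε₀ hε₀1 hK hN hs.1 (hgood s hs) (Or.inr (Or.inr rfl))
  have hE2 : ∀ s ∈ Icc 0 T, Er 2 s ≤ (K ^ 30)⁻¹ := by
    intro s hs
    have ha := (hgood s hs).after 1 le_rfl
    have e1 : (1 : ℤ) + ((1 : ℕ) : ℤ) = 2 := by norm_num
    rw [e1] at ha
    have hle : (1 + ε₀) ^ (-(10 : ℝ) * ((1 : ℕ) : ℝ)) ≤ 1 :=
      Real.rpow_le_one_of_one_le_of_nonpos hq1 (by norm_num)
    calc Er 2 s ≤ (K ^ 30)⁻¹ * (1 + ε₀) ^ (-(10 : ℝ) * ((1 : ℕ) : ℝ)) := ha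
      _ ≤ (K ^ 30)⁻¹ * 1 := mul_le_mul_of_nonneg_left hle (by positivity)
      _ = (K ^ 30)⁻¹ := mul_one _
  obtain ⟨hb, hc, hcl, -⟩ := h.prop613_regime hε₀ hε₀1 hK1 hε hε1 hC₁ hC₃ hN hκ hKa hKc hKd hδ1 hδ2
    hT.1 hT.2 hE1 hE2 hP hw hTw ht
  have hKf : 100 * (54 * Real.sqrt 2 * K ^ (-(1 : ℝ) / 4) * Real.exp (-(94 / 100) * K ^ 10) +
      4 * C₁ * (1 + ε₀) ^ (-(n₀ : ℝ) / 2)) ≤ (K ^ 15)⁻¹ := by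
    have e : 100 * (54 * Real.sqrt 2 * K ^ (-(1 : ℝ) / 4) * Real.exp (-(94 / 100) * K ^ 10) +
        4 * C₁ * (1 + ε₀) ^ (-(n₀ : ℝ) / 2)) =
        100 * (54 * Real.sqrt 2) * K ^ (-(1 : ℝ) / 4) * Real.exp (-(94 / 100) * K ^ 10) +
          400 * C₁ * (1 + ε₀) ^ (-(n₀ : ℝ) / 2) := by ring
    rw [e]; linarith
  have hd := h.prop613_d_one_lt hε₀ hε₀1 hK hε hε1 hC₁ hC₃ hN hκ hKa hKc hKd hδ1 hδ2 hKe hKf hT.1 hT.2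
    hE1 hE2 hP hw hTw ht
  refine ⟨hb, ?_, ?_, hd⟩
  · -- `9 K^{-1/4} e^{-(94/100)K¹⁰} ε² ≤ K^{-1/4} e^{-K¹⁰/2} ε²`
    refine hc.trans ?_
    have h9 := nine_mul_exp_neg_le_exp_neg_half hK
    have h0 : 0 ≤ K ^ (-(1 : ℝ) / 4) * ε ^ 2 := by positivity
    calc 9 * K ^ (-(1 : ℝ) / 4) * Real.exp (-(94 / 100) * K ^ 10) * ε ^ 2
        = (9 * Real.exp (-(94 / 100) * K ^ 10)) * (K ^ (-(1 : ℝ) / 4) * ε ^ 2) := by ring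
      _ ≤ Real.exp (-K ^ 10 / 2) * (K ^ (-(1 : ℝ) / 4) * ε ^ 2) := mul_le_mul_of_nonneg_right h9 h0
      _ = K ^ (-(1 : ℝ) / 4) * Real.exp (-K ^ 10 / 2) * ε ^ 2 := by ring
  · -- absorption of (6.118); the `a`-asymmetry integral stays
    refine le_trans ?_ hcl
    have e : Real.exp (6 / 100 * K ^ 10) * (4 * C₁ * (1 + ε₀) ^ (-(n₀ : ℝ) / 2) *
          (Real.exp 1 * (6 * Real.sqrt 2 * K) * cumEnergyConst ε₀ C₃ * C₃ *
            geomConst ε₀ ((496 : ℝ) / 100) + 100))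
        = Real.exp (6 / 100 * K ^ 10) * (4 * C₁ *
          (Real.exp 1 * (6 * Real.sqrt 2 * K) * cumEnergyConst ε₀ C₃ * C₃ *
            geomConst ε₀ ((496 : ℝ) / 100) + 100)) * (1 + ε₀) ^ (-(n₀ : ℝ) / 2) := by ring
    rw [mul_add, e]
    linarith [hδ4]

end Pointwise

end Tao2016AveragedNS

end Literature.Analysis.FluidPDE
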